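import Literature.Geometry.Lorentzian.SpacetimeConstSmul
import Literature.Geometry.Lorentzian.NullInfinity
import Literature.Geometry.Lorentzian.GeodesicProofs
import HarnessLib

/-!
# Completeness of future null infinity is dilation covariant

For a time-oriented Lorentzian manifold `(M, g, τ)` with data hypersurface `ι : X → M` and future
unit normal `N`, and a constant `a > 0`, consider the rescaled structure `(M, a² g, τ, ι, a⁻¹ N)`
(`LorentzianMetric.constSmul`, `SpacetimeConstSmul.lean`). A `(g, N)`-normalised future null ray
`γ` with affine domain `dom` (`IsNormalisedNullRayFrom`) reparametrises to the
`(a² g, a⁻¹ N)`-normalised ray `t ↦ γ (a⁻¹ t)` with domain `a • dom`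
(`isNormalisedNullRayFrom_constSmul_comp_mul`: the Levi-Civita connection is unchanged,
`leviCivita_constSmul`; affine reparametrisations of (maximal) geodesics are (maximal) geodesics,
`IsMaximalGeodesicOn.comp_mul`; `a² g(a⁻¹ γ'(0), a⁻¹ N) = g(γ'(0), N) = -1`), whose sojourn time in
any set is `a` times that of `γ` (`sojournTime_comp_mul`, Lebesgue measure under `t ↦ a t`), while
causal futures are unchanged (`causalFuture_constSmul`). Hence Christodoulou's completeness of
future null infinity in the sojourn form (`HasCompleteFutureNullInfinity`, `NullInfinity.lean`)
passes from `(a² g, a⁻¹ N)` to `(g, N)` (`hasCompleteFutureNullInfinity_of_constSmul`: for the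
threshold `s` use the compact set provided for `a s`). No definitions, no named facts.

## References

* D. Christodoulou, *On the global initial value problem and the issue of singularities*, CQG 16
  (1999) A23, pp. A26–A27. [Christodoulou1999]
* M. Dafermos, I. Rodnianski, *Lectures on black holes and linear waves*, arXiv:0811.0354, §2.6.2.
  [arXiv08110354]
* B. O'Neill, *Semi-Riemannian geometry*, 1983, Ch. 3, Def. 3.20, Lemma 3.21, p. 68 (affine
  reparametrisation, maximal geodesics). [ONeill1983]
-/

noncomputable section

open Manifold Bundle Set Filter MeasureTheory
open scoped ContDiff Topology ENNReal

namespace Literature.Geometry.Lorentzian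

variable {E : Type*} [NormedAddCommGroup E] [NormedSpace ℝ E] {H : Type*} [TopologicalSpace H]
  {I : ModelWithCorners ℝ E H} {M : Type*} [TopologicalSpace M] [ChartedSpace H M]
  [IsManifold I ∞ M]

/-! ### Linear reparametrisation of (maximal) geodesics -/

section Geodesic

variable [FiniteDimensional ℝ E] {cov : CovariantDerivative I E (TangentSpace I : M → Type _)}

omit [IsManifold I ∞ M] [FiniteDimensional ℝ E] in
/-- Velocity of a linearly reparametrised curve: `(γ(a ·))'(t) = a γ'(a t)` (O'Neill 1983, Ch. 3,
proof of Lemma 3.21; `velocity_comp_affine` with `b = 0`). [cite: ONeill1983, Ch. 3, Lemma 3.21] -/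
theorem velocity_comp_mul (γ : ℝ → M) (a t : ℝ) :
    velocity I (fun t ↦ γ (a * t)) t = a • velocity I γ (a * t) := by
  have h := velocity_comp_affine (I := I) γ a 0 t
  have e : (fun t ↦ γ (a * t + 0)) = fun t ↦ γ (a * t) := by
    funext u
    rw [add_zero]
  rw [e, add_zero] at h
  exact h

/-- A linear reparametrisation `t ↦ γ (a t)` of a geodesic on `s` is a geodesic on `(a ·)⁻¹' s`
(O'Neill 1983, Ch. 3, Def. 3.20; `IsGeodesicOn.comp_affine_holds` with `b = 0`).
[cite: ONeill1983, Ch. 3, Def. 3.20] -/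
theorem IsGeodesicOn.comp_mul {γ : ℝ → M} {s : Set ℝ} (h : IsGeodesicOn cov γ s) (a : ℝ) :
    IsGeodesicOn cov (fun t ↦ γ (a * t)) ((fun t ↦ a * t) ⁻¹' s) := by
  simpa using IsGeodesicOn.comp_affine_holds h a 0

omit [IsManifold I ∞ M] [FiniteDimensional ℝ E] in
/-- The preimage of an order-connected set of reals under `t ↦ a t` is order connected. [folklore] -/
theorem ordConnected_preimage_mul {s : Set ℝ} (hs : s.OrdConnected) (a : ℝ) :
    ((fun t ↦ a * t) ⁻¹' s).OrdConnected := by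
  rcases le_or_gt 0 a with ha | ha
  · exact hs.preimage_mono fun x y hxy ↦ mul_le_mul_of_nonneg_left hxy ha
  · exact hs.preimage_anti fun x y hxy ↦ mul_le_mul_of_nonpos_left hxy ha.le

/-- **Linear reparametrisations of maximal geodesics are maximal**: if `γ` is a maximal geodesic
with domain `s`, then for `a ≠ 0` so is `t ↦ γ (a t)` with domain `(a ·)⁻¹' s` (an extension of the
reparametrised geodesic would reparametrise back, by `a⁻¹`, to an extension of `γ`). O'Neill 1983,
Ch. 3, p. 68 with Lemma 3.21. [cite: ONeill1983, Ch. 3, p. 68] -/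
theorem IsMaximalGeodesicOn.comp_mul {γ : ℝ → M} {s : Set ℝ} (hγ : IsMaximalGeodesicOn cov γ s)
    {a : ℝ} (ha : a ≠ 0) :
    IsMaximalGeodesicOn cov (fun t ↦ γ (a * t)) ((fun t ↦ a * t) ⁻¹' s) := by
  obtain ⟨hso, hsc, hg, hmax⟩ := hγ
  refine ⟨hso.preimage (continuous_const_mul a), ordConnected_preimage_mul hsc a,
    hg.comp_mul a, fun γ'' s'' hs''o hs''c hsub hg'' heq ↦ ?_⟩
  -- reparametrise the candidate extension back
  have hsub' : s ⊆ (fun u ↦ a⁻¹ * u) ⁻¹' s'' := fun u hu ↦ hsub (by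
    show a * (a⁻¹ * u) ∈ s
    rwa [← mul_assoc, mul_inv_cancel₀ ha, one_mul])
  have heq' : EqOn γ (fun u ↦ γ'' (a⁻¹ * u)) s := fun u hu ↦ by
    have h1 : a⁻¹ * u ∈ (fun t ↦ a * t) ⁻¹' s := by
      show a * (a⁻¹ * u) ∈ s
      rwa [← mul_assoc, mul_inv_cancel₀ ha, one_mul]
    have h2 := heq h1
    simp only [← mul_assoc, mul_inv_cancel₀ ha, one_mul] at h2
    exact h2
  have h := hmax (fun u ↦ γ'' (a⁻¹ * u)) ((fun u ↦ a⁻¹ * u) ⁻¹' s'')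
    (hs''o.preimage (continuous_const_mul a⁻¹)) (ordConnected_preimage_mul hs''c a⁻¹) hsub'
    (hg''.comp_mul a⁻¹) heq'
  ext t
  refine ⟨fun ht ↦ ?_, fun ht ↦ hsub ht⟩
  have : a * t ∈ (fun u ↦ a⁻¹ * u) ⁻¹' s'' := by
    show a⁻¹ * (a * t) ∈ s''
    rwa [← mul_assoc, inv_mul_cancel₀ ha, one_mul]
  rwa [h] at this

omit [IsManifold I ∞ M] [FiniteDimensional ℝ E] in
/-- For `a > 0`, `(a ·)⁻¹' s` is bounded above iff `s` is. [folklore] -/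
theorem bddAbove_preimage_mul_iff {s : Set ℝ} {a : ℝ} (ha : 0 < a) :
    BddAbove ((fun t ↦ a * t) ⁻¹' s) ↔ BddAbove s := by
  constructor
  · rintro ⟨B, hB⟩
    refine ⟨a * B, fun u hu ↦ ?_⟩
    have h : a⁻¹ * u ∈ (fun t ↦ a * t) ⁻¹' s := by
      show a * (a⁻¹ * u) ∈ s
      rwa [← mul_assoc, mul_inv_cancel₀ ha.ne', one_mul]
    have := mul_le_mul_of_nonneg_left (hB h) ha.le
    rwa [← mul_assoc, mul_inv_cancel₀ ha.ne', one_mul] at this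
  · rintro ⟨B, hB⟩
    exact ⟨a⁻¹ * B, fun t ht ↦ by
      have := mul_le_mul_of_nonneg_left (hB ht) (inv_pos.2 ha).le
      rwa [← mul_assoc, inv_mul_cancel₀ ha.ne', one_mul] at this⟩

end Geodesic

/-! ### Sojourn times under linear reparametrisation -/

/-- **Sojourn times scale under `t ↦ a t`**: the affine time that `t ↦ γ (a t)` (domain `(a ·)⁻¹' dom`)
spends in `A` after parameter `0` is `a⁻¹` times that of `γ` (`a > 0`; Lebesgue measure of a
preimage under multiplication, `Real.volume_preimage_mul_left`). Christodoulou, CQG 16 (1999), p. A27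
(the affine parameter is fixed up to this normalisation). [folklore] -/
theorem sojournTime_comp_mul {M' : Type*} (γ : ℝ → M') (dom : Set ℝ) (A : Set M') {a : ℝ}
    (ha : 0 < a) :
    sojournTime (fun t ↦ γ (a * t)) ((fun t ↦ a * t) ⁻¹' dom) A =
      ENNReal.ofReal a⁻¹ * sojournTime γ dom A := by
  unfold sojournTime
  have hset : {t : ℝ | t ∈ (fun t ↦ a * t) ⁻¹' dom ∧ 0 ≤ t ∧ γ (a * t) ∈ A} =
      (fun t ↦ a * t) ⁻¹' {t : ℝ | t ∈ dom ∧ 0 ≤ t ∧ γ t ∈ A} := by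
    ext t
    simp only [mem_setOf_eq, mem_preimage]
    rw [mul_nonneg_iff_of_pos_left ha]
  rw [hset, Real.volume_preimage_mul_left ha.ne', abs_of_pos (inv_pos.2 ha)]

/-! ### Normalised null rays and completeness of `𝓘⁺` under `(g, N) ↦ (a² g, a⁻¹ N)` -/

namespace LorentzianMetric

variable {X : Type*} (g : LorentzianMetric I ∞ M) (τ : TimeOrientation g) (ι : X → M)
  [FiniteDimensional ℝ E] [CompleteSpace E] [g.HasLeviCivita] (N : NormalField I ι)
  {a : ℝ} (ha : 0 < a) [(g.constSmul (a ^ 2) (pow_pos ha 2)).HasLeviCivita]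

omit [FiniteDimensional ℝ E] [CompleteSpace E] in
/-- The Levi-Civita connection of `a² g` is that of `g` (`leviCivita_constSmul`, restated for the
bundled Lorentzian rescaling). O'Neill 1983, Ch. 3, Thm. 3.11. [cite: ONeill1983, Ch. 3, Thm. 3.11] -/
theorem leviCivita_constSmul_sq : (g.constSmul (a ^ 2) (pow_pos ha 2)).leviCivita = g.leviCivita := by
  haveI : (g.toPseudoRiemannianMetric.constSmul (a ^ 2) (pow_pos ha 2).ne').HasLeviCivita :=
    ‹(g.constSmul (a ^ 2) (pow_pos ha 2)).HasLeviCivita›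
  exact PseudoRiemannianMetric.leviCivita_constSmul (g := g.toPseudoRiemannianMetric) (a ^ 2)
    (pow_pos ha 2).ne'

omit [CompleteSpace E] in
/-- **Normalised null rays rescale.** If `γ` is a `(g, N)`-normalised future null ray from `p` with
affine domain `dom`, then `t ↦ γ (a⁻¹ t)` is an `(a² g, a⁻¹ N)`-normalised future null ray from `p`
with domain `(a⁻¹ ·)⁻¹' dom`: same (maximal) geodesics up to the affine reparametrisation
(`IsMaximalGeodesicOn.comp_mul`, `leviCivita_constSmul`), velocity `a⁻¹ γ'(0)` still null and
future-directed, and `a² g(a⁻¹ γ'(0), a⁻¹ N p) = g(γ'(0), N p) = -1`. Christodoulou, CQG 16 (1999),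
p. A26. [cite: Christodoulou1999, p. A26] -/
theorem isNormalisedNullRayFrom_constSmul_comp_mul {p : X} {γ : ℝ → M} {dom : Set ℝ}
    (h : g.IsNormalisedNullRayFrom τ ι N p γ dom) :
    (g.constSmul (a ^ 2) (pow_pos ha 2)).IsNormalisedNullRayFrom (τ.constSmul (a ^ 2) (pow_pos ha 2))
      ι (a⁻¹ • N) p (fun t ↦ γ (a⁻¹ * t)) ((fun t ↦ a⁻¹ * t) ⁻¹' dom) := by
  obtain ⟨hmax, h0, hγ0, hnull, hfut, hnorm⟩ := h
  have ha0 : a ≠ 0 := ha.ne'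
  have hv : velocity I (fun t ↦ γ (a⁻¹ * t)) 0 = a⁻¹ • velocity I γ 0 := by
    rw [velocity_comp_mul, mul_zero]
  refine ⟨?_, ?_, ?_, ?_, ?_, ?_⟩
  · rw [g.leviCivita_constSmul_sq ha]
    exact hmax.comp_mul (inv_ne_zero ha0)
  · show a⁻¹ * 0 ∈ dom
    rwa [mul_zero]
  · show γ (a⁻¹ * 0) = ι p
    rw [mul_zero, hγ0]
  · rw [hv]
    beta_reduce
    rw [mul_zero, LorentzianMetric.isNull_constSmul_iff]
    refine ⟨?_, smul_ne_zero (inv_ne_zero ha0) hnull.2⟩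
    simp only [map_smul, FunLike.coe_smul, Pi.smul_apply, smul_eq_mul, hnull.1, mul_zero]
  · rw [hv]
    beta_reduce
    rw [mul_zero, TimeOrientation.isFutureDirected_constSmul_iff]
    exact hfut.smul (inv_pos.2 ha)
  · rw [hv, hγ0, LorentzianMetric.constSmul_apply]
    simp only [Pi.smul_apply, map_smul, FunLike.coe_smul, smul_eq_mul, hnorm]
    field_simp

omit [CompleteSpace E] in
/-- **Completeness of future null infinity is dilation covariant** (sojourn form,
`HasCompleteFutureNullInfinity`): if `(M, a² g, τ, ι, a⁻¹ N)` has complete future null infinity then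
so has `(M, g, τ, ι, N)`. Given the compact `B₀` for the rescaled structure and a threshold `s > 0`,
take the compact `B₁` provided for `a s`: a `(g, N)`-normalised ray `γ` from outside `B₁` rescales
to an `(a² g, a⁻¹ N)`-normalised ray `t ↦ γ(a⁻¹ t)` (`isNormalisedNullRayFrom_constSmul_comp_mul`)
which is future complete iff `γ` is (`bddAbove_preimage_mul_iff`) and whose sojourn time in
`J⁺(ι B₀)` — the same set for both metrics, `causalFuture_constSmul` — is `a` times that of `γ`
(`sojournTime_comp_mul`). Christodoulou, CQG 16 (1999), pp. A26–A27; Dafermos–Rodnianski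
arXiv:0811.0354, §2.6.2. [cite: Christodoulou1999, pp. A26–A27] -/
theorem hasCompleteFutureNullInfinity_of_constSmul [TopologicalSpace X]
    (h : (g.constSmul (a ^ 2) (pow_pos ha 2)).HasCompleteFutureNullInfinity
      (τ.constSmul (a ^ 2) (pow_pos ha 2)) ι (a⁻¹ • N)) :
    g.HasCompleteFutureNullInfinity τ ι N := by
  obtain ⟨B₀, hB₀, hB⟩ := h
  refine ⟨B₀, hB₀, fun s hs ↦ ?_⟩
  obtain ⟨B₁, hB₁, hB'⟩ := hB (a * s) (mul_pos ha hs)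
  refine ⟨B₁, hB₁, fun p hp γ dom hγ ↦ ?_⟩
  rcases hB' p hp _ _ (g.isNormalisedNullRayFrom_constSmul_comp_mul τ ι N ha hγ) with hb | hsoj
  · exact Or.inl fun hb' ↦ hb ((bddAbove_preimage_mul_iff (inv_pos.2 ha)).2 hb')
  · right
    rw [g.causalFuture_constSmul τ (pow_pos ha 2), sojournTime_comp_mul γ dom _ (inv_pos.2 ha),
      inv_inv, ENNReal.ofReal_mul ha.le] at hsoj
    exact (ENNReal.mul_le_mul_iff_right ((ENNReal.ofReal_pos.2 ha).ne') ENNReal.ofReal_ne_top).1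
      hsoj

end LorentzianMetric

end Literature.Geometry.Lorentzian

end
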